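import Summits.CriticalPhenomena.CardyFormulaZ2.Theorems.CardyWhiteToColouredNoiseDiscretisationCells
import Summits.CriticalPhenomena.CardyFormulaZ2.Theorems.CardyWhiteToColouredNoiseDiscretisationEnvelope

/-!
# The Gaussian mass of the cell margins

Helper file for item `NoiseDiscretisation` (stmt-CriticalPhenomena-4598) of route
`CardyWhiteToColoured` (`CardyFormulaZ2`). The cell bumps of the coupling are equal to `1` on the
*plateaus* `{Dg[· − m_δ(e)] ≤ (1 − θ) δ/2}` of the medial cells; the discrepancy between the
smoothed lattice noise and the smoothed continuum noise at a point `x` has an `L²` contribution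
`J(x) = ∫ K(y − x)² 𝟙[y off all plateaus] dy` from the margins of the cells. We prove
`J(x) ≤ 60 θ ℓ²` for `0 < δ ≤ ℓ`, `0 < θ < 1` (`lintegral_gaussWeight_sq_offPlateau_le`):

* the closed cells `{Dg[· − m_δ(e)] ≤ δ/2}` cover the plane (rounding in the rotated
  coordinates, `exists_dg_sub_medialPoint_le`), the open cells are pairwise disjoint
  (separation of the medial lattice), and cells are dilated translates of the unit diamond, so
  their volumes scale like the square of the radius (`Measure.addHaar_smul_of_nonneg`); hence the
  margin of a cell has volume `≤ 3θ ·` the volume of the open cell;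
* on a closed cell `K(· − x)²` is bounded by `e · exp(−‖y' − x‖²/(2ℓ²))` for every point `y'` of
  the open cell (shifted envelope), so the Gaussian mass of a margin is at most `3θ` times the
  integral of that envelope over the open cell; summing over the disjoint open cells bounds `J(x)`
  by `3θ e ∫ exp(−‖v‖²/(2ℓ²)) = 6 e π θ ℓ² ≤ 60 θ ℓ²`.

References: S. Muirhead, H. Vanneuville, Ann. Inst. H. Poincaré Probab. Stat. 56 (2020), §3.
-/

noncomputable section

namespace Summit.CriticalPhenomena.CardyFormulaZ2.Theorems

namespace WhiteToColoured

open Set Metric MeasureTheory Filter Topology Real ENNReal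
open scoped Pointwise
open Literature.Probability.LatticeModels Literature.Probability.Percolation

/-- `Dg[w] = max |Re w + Im w| |Re w − Im w| = |Re w| + |Im w|`, the rotated sup-distance. -/
local notation3 "Dg[" w "]" => max |Complex.re w + Complex.im w| |Complex.re w - Complex.im w|

/-! ### Covering by closed cells -/

/-- **The closed medial cells cover the plane**: every point is within rotated sup-distance
`δ/2` of the medial point of some edge of `ℤ²` (round the rotated coordinates to the nearest
half-odd multiples of `δ`). -/
theorem exists_dg_sub_medialPoint_le {δ : ℝ} (hδ : 0 < δ) (y : ℂ) :
    ∃ e ∈ (zdGraph 2).edgeSet, Dg[y - medialPoint δ e] ≤ δ / 2 := by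
  set P : ℝ := y.re + y.im with hP
  set Q : ℝ := y.re - y.im with hQ
  set j : ℤ := ⌊P / δ⌋ with hj
  set j' : ℤ := ⌊Q / δ⌋ with hj'
  have hjP : |P - δ * (j + 1 / 2)| ≤ δ / 2 := by
    have h1 := Int.floor_le (P / δ)
    have h2 := Int.lt_floor_add_one (P / δ)
    rw [← hj] at h1 h2
    rw [abs_le]
    rw [le_div_iff₀ hδ] at h1
    rw [div_lt_iff₀ hδ] at h2
    constructor <;> nlinarith
  have hjQ : |Q - δ * (j' + 1 / 2)| ≤ δ / 2 := by
    have h1 := Int.floor_le (Q / δ)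
    have h2 := Int.lt_floor_add_one (Q / δ)
    rw [← hj'] at h1 h2
    rw [abs_le]
    rw [le_div_iff₀ hδ] at h1
    rw [div_lt_iff₀ hδ] at h2
    constructor <;> nlinarith
  -- the edge with rotated coordinates `(δ (j + 1/2), δ (j' + 1/2))`
  rcases Int.even_or_odd (j + j') with hpar | hpar
  · obtain ⟨k, hk⟩ := hpar
    -- `i = 0`, `u = (k, j - k)` : then `u 0 + u 1 = j`, `u 0 - u 1 = j'`
    set u : Site 2 := ![k, j - k] with hu
    set v : Site 2 := Pi.single 0 1 with hv
    refine ⟨s(u, u + v), mem_edgeSet_zdGraph_iff.2 ⟨u, 0, rfl⟩, ?_⟩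
    obtain ⟨hre, him⟩ := medialPoint_re_im δ u (u + v)
    have hu0 : ((u + v) 0 : ℤ) = k + 1 := by simp [hu, hv]
    have hu1 : ((u + v) 1 : ℤ) = j - k := by simp [hu, hv]
    have hk0 : (u 0 : ℤ) = k := by simp [hu]
    have hk1 : (u 1 : ℤ) = j - k := by simp [hu]
    have hre' : (medialPoint δ s(u, u + v)).re = δ * (2 * (k : ℝ) + 1) / 2 := by
      rw [hre, hu0, hk0]; push_cast; ring
    have him' : (medialPoint δ s(u, u + v)).im = δ * (2 * ((j : ℝ) - k)) / 2 := by
      rw [him, hu1, hk1]; push_cast; ring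
    have hjj : (j' : ℝ) = 2 * k - j := by
      have : (j + j' : ℤ) = k + k := hk
      have : (j' : ℤ) = 2 * k - j := by omega
      exact_mod_cast this
    simp only [Complex.sub_re, Complex.sub_im, hre', him']
    refine max_le ?_ ?_
    · have : y.re - δ * (2 * (k : ℝ) + 1) / 2 + (y.im - δ * (2 * ((j : ℝ) - k)) / 2) =
          P - δ * (j + 1 / 2) := by rw [hP]; ring
      rw [this]; exact hjP
    · have : y.re - δ * (2 * (k : ℝ) + 1) / 2 - (y.im - δ * (2 * ((j : ℝ) - k)) / 2) =
          Q - δ * (j' + 1 / 2) := by rw [hQ, hjj]; ring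
      rw [this]; exact hjQ
  · obtain ⟨k, hk⟩ := hpar
    -- `i = 1`, `u 0 + u 1 = j`, `u 0 - u 1 - 1 = j'` : `u = (k + 1, j - k - 1)`
    set u : Site 2 := ![k + 1, j - k - 1] with hu
    set v : Site 2 := Pi.single 1 1 with hv
    refine ⟨s(u, u + v), mem_edgeSet_zdGraph_iff.2 ⟨u, 1, rfl⟩, ?_⟩
    obtain ⟨hre, him⟩ := medialPoint_re_im δ u (u + v)
    have hu0 : ((u + v) 0 : ℤ) = k + 1 := by simp [hu, hv]
    have hu1 : ((u + v) 1 : ℤ) = j - k := by simp [hu, hv]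
    have hk0 : (u 0 : ℤ) = k + 1 := by simp [hu]
    have hk1 : (u 1 : ℤ) = j - k - 1 := by simp [hu]
    have hre' : (medialPoint δ s(u, u + v)).re = δ * (2 * ((k : ℝ) + 1)) / 2 := by
      rw [hre, hu0, hk0]; push_cast; ring
    have him' : (medialPoint δ s(u, u + v)).im =
        δ * (2 * ((j : ℝ) - k) - 1) / 2 := by
      rw [him, hu1, hk1]; push_cast; ring
    have hjj : (j' : ℝ) = 2 * k + 1 - j := by
      have : (j + j' : ℤ) = 2 * k + 1 := hk
      have : (j' : ℤ) = 2 * k + 1 - j := by omega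
      exact_mod_cast this
    simp only [Complex.sub_re, Complex.sub_im, hre', him']
    refine max_le ?_ ?_
    · have : y.re - δ * (2 * ((k : ℝ) + 1)) / 2 + (y.im - δ * (2 * ((j : ℝ) - k) - 1) / 2) =
          P - δ * (j + 1 / 2) := by rw [hP]; ring
      rw [this]; exact hjP
    · have : y.re - δ * (2 * ((k : ℝ) + 1)) / 2 - (y.im - δ * (2 * ((j : ℝ) - k) - 1) / 2) =
          Q - δ * (j' + 1 / 2) := by rw [hQ, hjj]; ring
      rw [this]; exact hjQ

/-! ### Cells: measurability, disjointness, scaling of volumes -/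

/-- The rotated sup-distance is continuous. -/
theorem continuous_dg_sub (m : ℂ) : Continuous fun y : ℂ => Dg[y - m] := by
  fun_prop

/-- Open cells are open. -/
theorem isOpen_cell (m : ℂ) (r : ℝ) : IsOpen {y : ℂ | Dg[y - m] < r} :=
  isOpen_lt (continuous_dg_sub m) continuous_const

/-- Closed cells are closed. -/
theorem isClosed_ccell (m : ℂ) (r : ℝ) : IsClosed {y : ℂ | Dg[y - m] ≤ r} :=
  isClosed_le (continuous_dg_sub m) continuous_const

/-- **Open cells of distinct edges are disjoint.** -/
theorem disjoint_cell {δ : ℝ} (hδ : 0 < δ) {e e' : Sym2 (Site 2)} (he : e ∈ (zdGraph 2).edgeSet)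
    (he' : e' ∈ (zdGraph 2).edgeSet) (hne : e ≠ e') :
    Disjoint {y : ℂ | Dg[y - medialPoint δ e] < δ / 2} {y : ℂ | Dg[y - medialPoint δ e'] < δ / 2} := by
  rw [Set.disjoint_left]
  intro y hy hy'
  simp only [mem_setOf_eq] at hy hy'
  have hsep := le_dg_medialPoint_sub hδ he he' hne
  have := dg_sub_le (medialPoint δ e) y (medialPoint δ e')
  rw [dg_sub_comm (medialPoint δ e) y] at this
  linarith

/-- `Dg` is positively homogeneous. -/
theorem dg_smul (r : ℝ) (hr : 0 ≤ r) (w : ℂ) : Dg[(r : ℂ) * w] = r * Dg[w] := by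
  simp only [Complex.mul_re, Complex.ofReal_re, Complex.ofReal_im, zero_mul, sub_zero,
    Complex.mul_im, add_zero]
  rw [show r * w.re + r * w.im = r * (w.re + w.im) by ring,
    show r * w.re - r * w.im = r * (w.re - w.im) by ring, abs_mul, abs_mul, abs_of_nonneg hr,
    mul_max_of_nonneg _ _ hr]

/-- **A cell is a dilated translate of the unit diamond.** -/
theorem cell_eq_vadd_smul (m : ℂ) {r : ℝ} (hr : 0 < r) :
    {y : ℂ | Dg[y - m] < r} = m +ᵥ (r • {w : ℂ | Dg[w] < 1}) := by
  ext y
  constructor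
  · intro hy
    have hy' : Dg[y - m] < r := hy
    refine Set.mem_vadd_set.2 ⟨y - m, Set.mem_smul_set.2 ⟨(r : ℂ)⁻¹ * (y - m), ?_, ?_⟩, ?_⟩
    · have h := dg_smul r⁻¹ (by positivity) (y - m)
      rw [Complex.ofReal_inv] at h
      show Dg[(r : ℂ)⁻¹ * (y - m)] < 1
      rw [h, inv_mul_lt_iff₀ hr, mul_one]
      exact hy'
    · rw [Complex.real_smul, ← mul_assoc, mul_inv_cancel₀ (by exact_mod_cast hr.ne'), one_mul]
    · show m + (y - m) = y
      ring
  · intro hy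
    obtain ⟨v, hv, rfl⟩ := Set.mem_vadd_set.1 hy
    obtain ⟨w, hw, rfl⟩ := Set.mem_smul_set.1 hv
    have hw' : Dg[w] < 1 := hw
    show Dg[m + (r : ℝ) • w - m] < r
    rw [show m + (r : ℝ) • w - m = (r : ℂ) * w by rw [Complex.real_smul]; ring, dg_smul r hr.le]
    nlinarith

/-- **Volumes of cells scale like the square of the radius.** -/
theorem volume_cell (m : ℂ) {r : ℝ} (hr : 0 < r) :
    volume {y : ℂ | Dg[y - m] < r} = ENNReal.ofReal (r ^ 2) * volume {w : ℂ | Dg[w] < 1} := by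
  rw [cell_eq_vadd_smul m hr, measure_vadd, Measure.addHaar_smul_of_nonneg volume hr.le,
    Complex.finrank_real_complex]

/-- The unit diamond has positive finite volume. -/
theorem volume_unitCell_pos : 0 < volume {w : ℂ | Dg[w] < 1} := by
  have h := isOpen_cell (0 : ℂ) 1
  simp only [sub_zero] at h
  exact h.measure_pos volume ⟨0, by simp⟩

/-- The unit diamond has finite volume. -/
theorem volume_unitCell_lt_top : volume {w : ℂ | Dg[w] < 1} < ∞ := by
  refine (measure_mono ?_).trans_lt (measure_ball_lt_top (μ := volume) (x := (0 : ℂ)) (r := 1))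
  intro w hw
  rw [mem_ball_zero_iff]
  exact (norm_le_dg w).trans_lt hw

/-- **The margin of a cell has volume at most `3θ` times the open cell.** Here the margin is the
closed cell of radius `δ/2` minus the open cell of radius `(1 − θ) δ/2`. -/
theorem volume_margin_le {δ θ : ℝ} (hδ : 0 < δ) (hθ0 : 0 < θ) (hθ1 : θ < 1) (m : ℂ) :
    volume ({y : ℂ | Dg[y - m] ≤ δ / 2} \ {y : ℂ | Dg[y - m] < (1 - θ) * δ / 2}) ≤
      ENNReal.ofReal (3 * θ) * volume {y : ℂ | Dg[y - m] < δ / 2} := by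
  -- closed cell ⊆ open cell of radius `(1 + θ/2) δ/2`
  have hsub : {y : ℂ | Dg[y - m] ≤ δ / 2} ⊆ {y : ℂ | Dg[y - m] < (1 + θ / 2) * (δ / 2)} := by
    intro y hy
    simp only [mem_setOf_eq] at hy ⊢
    nlinarith
  have hin : {y : ℂ | Dg[y - m] < (1 - θ) * δ / 2} ⊆ {y : ℂ | Dg[y - m] < (1 + θ / 2) * (δ / 2)} := by
    intro y hy
    simp only [mem_setOf_eq] at hy ⊢
    nlinarith
  have hfin : volume {y : ℂ | Dg[y - m] < (1 - θ) * δ / 2} ≠ ∞ := by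
    rw [show (1 - θ) * δ / 2 = (1 - θ) * (δ / 2) by ring, volume_cell m (by nlinarith)]
    exact ENNReal.mul_ne_top ENNReal.ofReal_ne_top volume_unitCell_lt_top.ne
  calc volume ({y : ℂ | Dg[y - m] ≤ δ / 2} \ {y : ℂ | Dg[y - m] < (1 - θ) * δ / 2})
      ≤ volume ({y : ℂ | Dg[y - m] < (1 + θ / 2) * (δ / 2)} \ {y : ℂ | Dg[y - m] < (1 - θ) * δ / 2}) :=
        measure_mono (sdiff_subset_sdiff_left hsub)
    _ = volume {y : ℂ | Dg[y - m] < (1 + θ / 2) * (δ / 2)} -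
          volume {y : ℂ | Dg[y - m] < (1 - θ) * δ / 2} :=
        measure_sdiff hin (isOpen_cell m _).measurableSet.nullMeasurableSet hfin
    _ = ENNReal.ofReal (((1 + θ / 2) * (δ / 2)) ^ 2) * volume {w : ℂ | Dg[w] < 1} -
          ENNReal.ofReal (((1 - θ) * (δ / 2)) ^ 2) * volume {w : ℂ | Dg[w] < 1} := by
        rw [volume_cell m (by positivity), show (1 - θ) * δ / 2 = (1 - θ) * (δ / 2) by ring,
          volume_cell m (by nlinarith)]
    _ = (ENNReal.ofReal (((1 + θ / 2) * (δ / 2)) ^ 2) - ENNReal.ofReal (((1 - θ) * (δ / 2)) ^ 2)) *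
          volume {w : ℂ | Dg[w] < 1} := by
        rw [ENNReal.sub_mul (fun _ _ => volume_unitCell_lt_top.ne)]
    _ ≤ (ENNReal.ofReal (3 * θ) * ENNReal.ofReal ((δ / 2) ^ 2)) * volume {w : ℂ | Dg[w] < 1} := by
        gcongr
        rw [← ENNReal.ofReal_sub _ (by positivity), ← ENNReal.ofReal_mul (by positivity)]
        apply ENNReal.ofReal_le_ofReal
        nlinarith [sq_nonneg δ, sq_nonneg θ]
    _ = ENNReal.ofReal (3 * θ) * volume {y : ℂ | Dg[y - m] < δ / 2} := by
        rw [volume_cell m (by positivity), mul_assoc]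

/-! ### The Gaussian mass of a margin and of all margins -/

/-- **The Gaussian mass of one margin** is at most `3θ` times the integral over the open cell of
the envelope `e · exp(−‖· − x‖²/(2ℓ²))`. -/
theorem lintegral_margin_le {ℓ δ θ : ℝ} (hℓ : 0 < ℓ) (hδ : 0 < δ) (hδℓ : δ ≤ ℓ) (hθ0 : 0 < θ)
    (hθ1 : θ < 1) (x m : ℂ) :
    ∫⁻ y in {y : ℂ | Dg[y - m] ≤ δ / 2} \ {y : ℂ | Dg[y - m] < (1 - θ) * δ / 2},
        ENNReal.ofReal (gaussWeight ℓ (y - x) ^ 2) ≤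
      ENNReal.ofReal (3 * θ) * ∫⁻ y' in {y : ℂ | Dg[y - m] < δ / 2},
        ENNReal.ofReal (Real.exp 1 * Real.exp (-‖y' - x‖ ^ 2 / (2 * ℓ ^ 2))) := by
  set M : Set ℂ := {y : ℂ | Dg[y - m] ≤ δ / 2} \ {y : ℂ | Dg[y - m] < (1 - θ) * δ / 2} with hM
  set C : Set ℂ := {y : ℂ | Dg[y - m] < δ / 2} with hC
  set W : ℂ → ℝ≥0∞ := fun y' => ENNReal.ofReal (Real.exp 1 * Real.exp (-‖y' - x‖ ^ 2 / (2 * ℓ ^ 2)))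
    with hW
  -- pointwise domination on the closed cell by the envelope at any point of the open cell
  have hdom : ∀ y ∈ M, ∀ y' ∈ C, ENNReal.ofReal (gaussWeight ℓ (y - x) ^ 2) ≤ W y' := by
    intro y hy y' hy'
    apply ENNReal.ofReal_le_ofReal
    refine gaussWeight_sq_le_of_norm_sub_le' hℓ hδ.le hδℓ ?_
    have h1 : Dg[y - m] ≤ δ / 2 := hy.1
    have h2 : Dg[y' - m] < δ / 2 := hy'
    have := dg_sub_le y' m y
    rw [dg_sub_comm m y] at this
    exact (norm_le_dg _).trans (by linarith)
  have hCvol : volume C = ENNReal.ofReal ((δ / 2) ^ 2) * volume {w : ℂ | Dg[w] < 1} :=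
    volume_cell m (by positivity)
  have hC0 : volume C ≠ 0 := by
    rw [hCvol]; exact mul_ne_zero (by positivity) volume_unitCell_pos.ne'
  have hCtop : volume C ≠ ∞ := by
    rw [hCvol]; exact ENNReal.mul_ne_top ENNReal.ofReal_ne_top volume_unitCell_lt_top.ne
  have hMmeas : MeasurableSet M :=
    (isClosed_ccell m _).measurableSet.diff (isOpen_cell m _).measurableSet
  have hCmeas : MeasurableSet C := (isOpen_cell m _).measurableSet
  -- `vol(C) · ∫_M K² ≤ vol(M) · ∫_C W`
  have key : volume C * ∫⁻ y in M, ENNReal.ofReal (gaussWeight ℓ (y - x) ^ 2) ≤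
      volume M * ∫⁻ y' in C, W y' := by
    calc volume C * ∫⁻ y in M, ENNReal.ofReal (gaussWeight ℓ (y - x) ^ 2)
        = ∫⁻ y' in C, ∫⁻ y in M, ENNReal.ofReal (gaussWeight ℓ (y - x) ^ 2) := by
          rw [setLIntegral_const, mul_comm]
      _ ≤ ∫⁻ y' in C, ∫⁻ y in M, W y' := by
          refine setLIntegral_mono' hCmeas fun y' hy' => ?_
          exact setLIntegral_mono' hMmeas fun y hy => hdom y hy y' hy'
      _ = ∫⁻ y' in C, volume M * W y' := by
          congr 1; funext y'; rw [setLIntegral_const, mul_comm]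
      _ = volume M * ∫⁻ y' in C, W y' := by
          refine lintegral_const_mul _ ?_
          rw [hW]; fun_prop
  have h2 : volume C * ∫⁻ y in M, ENNReal.ofReal (gaussWeight ℓ (y - x) ^ 2) ≤
      volume C * (ENNReal.ofReal (3 * θ) * ∫⁻ y' in C, W y') := by
    refine key.trans ?_
    calc volume M * ∫⁻ y' in C, W y'
        ≤ (ENNReal.ofReal (3 * θ) * volume C) * ∫⁻ y' in C, W y' :=
          mul_le_mul' (volume_margin_le hδ hθ0 hθ1 m) le_rfl
      _ = volume C * (ENNReal.ofReal (3 * θ) * ∫⁻ y' in C, W y') := by ring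
  exact (ENNReal.mul_le_mul_iff_right hC0 hCtop).1 h2

/-- **The Gaussian mass of all margins**: for `0 < δ ≤ ℓ` and `0 < θ < 1`,
`∫ K(y − x)² 𝟙[y off all plateaus] dy ≤ 60 θ ℓ²`, the plateaus being the closed cells of radius
`(1 − θ) δ/2` about the medial points of the edges of `ℤ²` at mesh `δ`. -/
theorem lintegral_gaussWeight_sq_offPlateau_le {ℓ δ θ : ℝ} (hℓ : 0 < ℓ) (hδ : 0 < δ) (hδℓ : δ ≤ ℓ)
    (hθ0 : 0 < θ) (hθ1 : θ < 1) (x : ℂ) :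
    ∫⁻ y in (⋃ e : (zdGraph 2).edgeSet, {y : ℂ | Dg[y - medialPoint δ e.1] ≤ (1 - θ) * δ / 2})ᶜ,
        ENNReal.ofReal (gaussWeight ℓ (y - x) ^ 2) ≤ ENNReal.ofReal (60 * θ * ℓ ^ 2) := by
  set E := (zdGraph 2).edgeSet with hE
  set M : E → Set ℂ := fun e =>
    {y : ℂ | Dg[y - medialPoint δ e.1] ≤ δ / 2} \ {y : ℂ | Dg[y - medialPoint δ e.1] < (1 - θ) * δ / 2}
    with hM
  set C : E → Set ℂ := fun e => {y : ℂ | Dg[y - medialPoint δ e.1] < δ / 2} with hC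
  set W : ℂ → ℝ≥0∞ := fun y' => ENNReal.ofReal (Real.exp 1 * Real.exp (-‖y' - x‖ ^ 2 / (2 * ℓ ^ 2)))
    with hW
  -- off the plateaus, every point lies in the margin of its cell
  have hcover : (⋃ e : E, {y : ℂ | Dg[y - medialPoint δ e.1] ≤ (1 - θ) * δ / 2})ᶜ ⊆ ⋃ e : E, M e := by
    intro y hy
    obtain ⟨e, he, hye⟩ := exists_dg_sub_medialPoint_le hδ y
    refine mem_iUnion.2 ⟨⟨e, he⟩, hye, fun h => hy (mem_iUnion.2 ⟨⟨e, he⟩, ?_⟩)⟩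
    have : Dg[y - medialPoint δ e] < (1 - θ) * δ / 2 := h
    exact this.le
  calc ∫⁻ y in (⋃ e : E, {y : ℂ | Dg[y - medialPoint δ e.1] ≤ (1 - θ) * δ / 2})ᶜ,
          ENNReal.ofReal (gaussWeight ℓ (y - x) ^ 2)
      ≤ ∫⁻ y in ⋃ e : E, M e, ENNReal.ofReal (gaussWeight ℓ (y - x) ^ 2) :=
        lintegral_mono_set hcover
    _ ≤ ∑' e : E, ∫⁻ y in M e, ENNReal.ofReal (gaussWeight ℓ (y - x) ^ 2) :=
        lintegral_iUnion_le _ _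
    _ ≤ ∑' e : E, ENNReal.ofReal (3 * θ) * ∫⁻ y' in C e, W y' :=
        ENNReal.tsum_le_tsum fun e => lintegral_margin_le hℓ hδ hδℓ hθ0 hθ1 x (medialPoint δ e.1)
    _ = ENNReal.ofReal (3 * θ) * ∫⁻ y' in ⋃ e : E, C e, W y' := by
        rw [ENNReal.tsum_mul_left, lintegral_iUnion (fun e => (isOpen_cell _ _).measurableSet)]
        intro e e' hne
        exact disjoint_cell hδ e.2 e'.2 fun h => hne (Subtype.ext h)
    _ ≤ ENNReal.ofReal (3 * θ) * ∫⁻ y', W y' := by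
        gcongr; exact Measure.restrict_le_self
    _ = ENNReal.ofReal (3 * θ) * ENNReal.ofReal (Real.exp 1 * (π * (2 * ℓ ^ 2))) := by
        congr 1
        rw [hW]
        simp_rw [ENNReal.ofReal_mul (Real.exp_pos 1).le]
        rw [lintegral_const_mul _ (by fun_prop), lintegral_exp_neg_sq_norm_sub_div (by positivity) x,
          ← ENNReal.ofReal_mul (Real.exp_pos 1).le]
    _ ≤ ENNReal.ofReal (60 * θ * ℓ ^ 2) := by
        rw [← ENNReal.ofReal_mul (by positivity)]
        apply ENNReal.ofReal_le_ofReal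
        have he : Real.exp 1 < 2.7182818286 := Real.exp_one_lt_d9
        have hπ : π < 3.1416 := Real.pi_lt_d4
        have h1 : Real.exp 1 * (π * (2 * ℓ ^ 2)) ≤ 2.7182818286 * (3.1416 * (2 * ℓ ^ 2)) := by
          gcongr
        nlinarith [sq_nonneg ℓ]

end WhiteToColoured

end Summit.CriticalPhenomena.CardyFormulaZ2.Theorems
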